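import Literature.NumberTheory.GelbartRogawski1991.UndoubledSplittingsUnitary
import Literature.NumberTheory.Automorphic.SchwartzBruhatL2UnitaryExtension
import HarnessLib

/-!
# The tree's local Weil representations of `U(J)(F_v)` are UNITARY REPRESENTATIONS on the Hilbert space `L²(F_vᴺ)`

Topic `NumberTheory/GelbartRogawski1991`; namespace `Literature.NumberTheory.GelbartRogawski1991.UnitaryDualPair.LocalSplitting`
(+ one lemma in `Literature.NumberTheory.Automorphic.SchwartzBruhat`, two theorems in `…GelbartRogawski1991.GRConstruction`).
KERNEL ONLY: one definition with body (`LocalSplittingDatum.localOmegaL2`) and proved theorems; no named fact, no record,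
no `sorry`.

[GelbartRogawski1991, §3.1 p. 454 L21–25] and [Weil1964, Chap. I n° 13] work with the UNITARY representation
`ω_ψ : (g, M_g) ↦ M_g` of the metaplectic group on the Hilbert space of `ρ_ψ`; the tree's construction of the local
splittings `s_v : U(J)(F_v) → S̃p_{ψ_v}(𝕎_v)` ([GelbartRogawski1991, Prop. 3.1.1], finite places; GR-1/GR-2 lineage) lives on
the SMOOTH model `𝒮(F_vᴺ)` and was shown `L²`-ISOMETRIC there (`LocalSplittingUnitary.lean`, `UndoubledSplittingsUnitary.lean`).
With `Automorphic/SchwartzBruhatL2Dense.lean` (𝒮 dense in L²) and `Automorphic/SchwartzBruhatL2UnitaryExtension.lean`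
(unitary extension of `L²`-isometric actions) this file records the Hilbert-space statements:

* §1 `SchwartzBruhat.denseRange_toLp_adicCompletionPi` — `𝒮(F_vᴺ) → L²(F_vᴺ, μ'ᴺ)` has dense range for any Haar measure
  `μ'` on `F_v` (`F` a number field, `v` finite);
* §2 for ANY local splitting datum `D` with `|β| = 1`: **`D.localOmegaL2 hβ μ' : U(J)(F_v) →* (L² ≃ₗᵢ[ℂ] L²)`**, the unitary
  representation of `U(J)(F_v)` on `L²(F_vᴺ, μ'ᴺ)` extending `D.localOmega` (`localOmegaL2_apply_toLp`), STRONGLY CONTINUOUS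
  (`continuous_localOmegaL2_apply`, from the smoothness of `ω_v`), unique among continuous extensions
  (`eq_localOmegaL2_of_apply_toLp`);
* §3 the CM data: the family `finLocalSplittingsCM χ` (`χ` a unitary Hecke character of the CM field `L` with
  `χ|_{𝔸_{L⁺}} = ε_{L/L⁺}`) and the END-display shape `congrW … (undoubledSplittings … (cmFinLocalFamily χ …))` of
  `GRConstruction` are, at every finite place `v` of `L⁺`, restrictions of strongly continuous UNITARY REPRESENTATIONS of `U(J)(L⁺_v)` on
  `L²((L⁺_v)ⁿ)` (`exists_unitaryRep_omegaLoc_finLocalSplittingsCM`,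
  `GRConstruction.exists_unitaryRep_omegaLoc_congrW_undoubledSplittings_cmFinLocalFamily`).

Written for Track 2 of the Hodge/COR-CM cell's
[GelbartRogawski1991, Prop. 3.1.1] citation (`Prop311AsPrinted`: the printed `Mp_𝐀(W)` acts on a Hilbert space); nothing of
[GelbartRogawski1991] or [Weil1964] is asserted here, and HC_CM is not touched.

## References
* [GelbartRogawski1991] S. Gelbart, J. Rogawski, Invent. Math. 105 (1991) 445–472, §3.1 pp. 454–455.
* [Weil1964] A. Weil, Acta Math. 111 (1964) 143–211, Chap. I n° 11–13.
* [Kudla1994] S. S. Kudla, Israel J. Math. 87 (1994) 361–401, Thm 3.1.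
* [MoeglinVignerasWaldspurger1987] C. Mœglin, M.-F. Vignéras, J.-L. Waldspurger, LNM 1291 (1987), Chap. 2 II.8 (smoothness).
-/

set_option autoImplicit false

noncomputable section

open scoped Kronecker
open NumberField IsDedekindDomain _root_.MeasureTheory Matrix
open Literature.RepresentationTheory.HeisenbergGroup
open Literature.NumberTheory.Automorphic Literature.NumberTheory.Weil1964
open Literature.NumberTheory.GaloisRepresentations Literature.RepresentationTheory.HarrisKudlaSweet1996

/-! ## §1 Density of `𝒮(F_vᴺ)` in `L²(F_vᴺ, μ'ᴺ)` -/

namespace Literature.NumberTheory.Automorphic.SchwartzBruhat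

/-- **`𝒮(F_vᴺ)` is dense in `L²(F_vᴺ, μ'ᴺ)`** for a finite place `v` of a number field `F` and any Haar measure `μ'` on
`F_v` (`F_vᴺ` is locally compact Hausdorff totally disconnected second countable; the product Haar measure is regular).
[cite: Weil1964, Chap. I n° 11] -/
theorem denseRange_toLp_adicCompletionPi (F : Type) [Field F] [NumberField F] (v : HeightOneSpectrum (𝓞 F)) (N : ℕ)
    [MeasurableSpace (v.adicCompletion F)] [BorelSpace (v.adicCompletion F)]
    (μ' : Measure (v.adicCompletion F)) [μ'.IsAddHaarMeasure] :
    haveI := secondCountableTopology_adicCompletion F v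
    DenseRange (toLp (Measure.pi fun _ : Fin N => μ') :
      SchwartzBruhat (Fin N → v.adicCompletion F) → Lp ℂ 2 (Measure.pi fun _ : Fin N => μ')) := by
  haveI := secondCountableTopology_adicCompletion F v
  exact denseRange_toLp _

end Literature.NumberTheory.Automorphic.SchwartzBruhat

namespace Literature.NumberTheory.GelbartRogawski1991.UnitaryDualPair.LocalSplitting

/-! ## §2 Any local splitting datum with unitary `β`: the unitary representation `localOmegaL2` on `L²(F_vᴺ)` -/

section Datum

variable {F : Type} [Field F] [NumberField F] {E : Type} [Field E] [NumberField E] [Algebra F E]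
  [Algebra.IsQuadraticExtension F E] {c : E ≃ₐ[F] E} {N : ℕ} {δ : E} {hcδ : c δ = -δ} {hδ : δ ≠ 0} {d : F}
  {hd : δ * δ = algebraMap F E d} {T : Matrix (Fin N) (Fin N) F} {hT : T.IsSymm} {hTd : IsUnit T.det}
  {J : Matrix (Fin N) (Fin N) E} {hJ : J = T.map (algebraMap F E)} {v : HeightOneSpectrum (𝓞 F)}
  [MeasurableSpace (v.adicCompletion F)] [BorelSpace (v.adicCompletion F)]
  {μ : Measure (v.adicCompletion F)} [μ.IsAddHaarMeasure]
  {ℓ : Submodule (v.adicCompletion F) ((Fin N → v.adicCompletion F) × (Fin N → v.adicCompletion F))}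
  {hℓ : LinearMap.BilinForm.orthogonal (alt (polar (localPairing F N T v))) ℓ = ℓ}

/-- **the UNITARY REPRESENTATION of `U(J)(F_v)` on `L²(F_vᴺ, μ'ᴺ)` attached to a local splitting datum with `|β| = 1`**:
the unique extension of `ω_v = β⁻¹ · r ∘ ι_v` (`D.localOmega`, on `𝒮(F_vᴺ)`, `L²`-isometric by
`isL2Isometric_localOmega_of_norm_beta`) to surjective linear isometries of the Hilbert space `Lp ℂ 2 (μ'ᴺ)`.
[cite: Weil1964, Chap. I n° 13] [cite: GelbartRogawski1991, §3.1 p. 454 L21–25] -/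
def LocalSplittingDatum.localOmegaL2 (D : LocalSplittingDatum F E c N hcδ hδ hd T hT hTd hJ v μ ℓ hℓ)
    (hβ : ∀ g : UnitaryGroup.localPi E c N J v, ‖((D.beta g : ℂˣ) : ℂ)‖ = 1)
    (μ' : Measure (v.adicCompletion F)) [μ'.IsAddHaarMeasure] :
    UnitaryGroup.localPi E c N J v →*
      (Lp ℂ 2 (Measure.pi fun _ : Fin N => μ') ≃ₗᵢ[ℂ] Lp ℂ 2 (Measure.pi fun _ : Fin N => μ')) := by
  haveI := secondCountableTopology_adicCompletion F v
  exact (D.isL2Isometric_localOmega_of_norm_beta μ' hβ).toUnitaryRep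
    (SchwartzBruhat.denseRange_toLp_adicCompletionPi F v N μ')

variable (D : LocalSplittingDatum F E c N hcδ hδ hd T hT hTd hJ v μ ℓ hℓ)
  (hβ : ∀ g : UnitaryGroup.localPi E c N J v, ‖((D.beta g : ℂˣ) : ℂ)‖ = 1)
  (μ' : Measure (v.adicCompletion F)) [μ'.IsAddHaarMeasure]

/-- **`localOmegaL2` extends `localOmega`**: on the class of a Schwartz–Bruhat function, `U(g) [Φ] = [ω_v(g) Φ]`.
[cite: Weil1964, Chap. I n° 13] -/
theorem LocalSplittingDatum.localOmegaL2_apply_toLp (g : UnitaryGroup.localPi E c N J v)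
    (Φ : SchwartzBruhat (Fin N → v.adicCompletion F)) :
    haveI := secondCountableTopology_adicCompletion F v
    D.localOmegaL2 hβ μ' g (SchwartzBruhat.toLp (Measure.pi fun _ : Fin N => μ') Φ) =
      SchwartzBruhat.toLp (Measure.pi fun _ : Fin N => μ') (D.localOmega g Φ) := by
  haveI := secondCountableTopology_adicCompletion F v
  exact (D.isL2Isometric_localOmega_of_norm_beta μ' hβ).toUnitaryRep_apply_toLp _ g Φ

/-- each `localOmegaL2 g` is norm-preserving on `L²`. [cite: Weil1964, Chap. I n° 13] -/
theorem LocalSplittingDatum.norm_localOmegaL2_apply (g : UnitaryGroup.localPi E c N J v)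
    (f : Lp ℂ 2 (Measure.pi fun _ : Fin N => μ')) : ‖D.localOmegaL2 hβ μ' g f‖ = ‖f‖ :=
  (D.localOmegaL2 hβ μ' g).norm_map f

/-- the local Weil representation `ω_v = β⁻¹ · r ∘ ι_v` of a local splitting datum is SMOOTH (the datum's field `smooth`:
every Schwartz–Bruhat function is fixed on an open subgroup). [cite: MoeglinVignerasWaldspurger1987, Chap. 2 II.8] -/
theorem LocalSplittingDatum.isSmooth_localOmega : D.localOmega.IsSmooth := by
  intro Φ
  obtain ⟨U, hU, hfix⟩ := D.smooth Φ
  rw [Representation.isSmoothVector_iff]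
  exact Subgroup.isOpen_mono (fun k hk => (D.localOmega.mem_stabilizerSubgroup Φ k).2 (hfix k hk)) hU

/-- **`localOmegaL2` is STRONGLY CONTINUOUS**: every orbit map `g ↦ U(g) f`, `f ∈ L²(F_vᴺ)`, is continuous (smoothness of
`ω_v` on the dense subspace `𝒮(F_vᴺ)` + unitarity). [cite: Weil1964, Chap. I n° 13] -/
theorem LocalSplittingDatum.continuous_localOmegaL2_apply (f : Lp ℂ 2 (Measure.pi fun _ : Fin N => μ')) :
    Continuous fun g : UnitaryGroup.localPi E c N J v => D.localOmegaL2 hβ μ' g f := by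
  haveI := secondCountableTopology_adicCompletion F v
  exact (D.isL2Isometric_localOmega_of_norm_beta μ' hβ).continuous_toUnitaryRep_apply_of_isSmooth _
    D.isSmooth_localOmega f

/-- **uniqueness**: a family of CONTINUOUS self-maps of `L²(F_vᴺ)` extending `ω_v` on Schwartz–Bruhat classes is
`localOmegaL2`. [cite: Weil1964, Chap. I n° 13] -/
theorem LocalSplittingDatum.eq_localOmegaL2_of_apply_toLp
    {U : UnitaryGroup.localPi E c N J v → Lp ℂ 2 (Measure.pi fun _ : Fin N => μ') → Lp ℂ 2 (Measure.pi fun _ : Fin N => μ')}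
    (hU : ∀ g, Continuous (U g))
    (hUω : haveI := secondCountableTopology_adicCompletion F v
      ∀ (g : UnitaryGroup.localPi E c N J v) (Φ : SchwartzBruhat (Fin N → v.adicCompletion F)),
        U g (SchwartzBruhat.toLp (Measure.pi fun _ : Fin N => μ') Φ) =
          SchwartzBruhat.toLp (Measure.pi fun _ : Fin N => μ') (D.localOmega g Φ))
    (g : UnitaryGroup.localPi E c N J v) : U g = D.localOmegaL2 hβ μ' g := by
  haveI := secondCountableTopology_adicCompletion F v
  exact (D.isL2Isometric_localOmega_of_norm_beta μ' hβ).eq_toUnitaryRep_of_apply_toLp _ hU hUω g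

end Datum

/-! ## §3 The CM data -/

section CM

variable (L : Type) [Field L] [NumberField L] [IsCMField L] (n : ℕ) {T₀ : Matrix (Fin n) (Fin n) (maximalRealSubfield L)}
  (hT₀ : T₀.IsSymm) (hT₀d : IsUnit T₀.det) {J : Matrix (Fin n) (Fin n) L}
  (hJ : J = T₀.map (algebraMap (maximalRealSubfield L) L)) (χ : HeckeCharacter L) (hχ : IsSplittingChar L 1 χ)
  (v : HeightOneSpectrum (𝓞 (maximalRealSubfield L)))

/-- **the CM family `finLocalSplittingsCM χ` is, at every finite place, the restriction of a strongly continuous UNITARY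
REPRESENTATION of `U(J)(L⁺_v)` on `L²((L⁺_v)ⁿ, μ'ⁿ)`** (`χ` unitary; any Borel structure, any Haar `μ'` on `L⁺_v`).
[cite: GelbartRogawski1991, §3.1 Prop. 3.1.1 p. 455 L1–3, p. 454 L21–25] [cite: Weil1964, Chap. I n° 13] -/
theorem exists_unitaryRep_omegaLoc_finLocalSplittingsCM (hχu : χ.IsUnitary)
    [MeasurableSpace (v.adicCompletion (maximalRealSubfield L))] [BorelSpace (v.adicCompletion (maximalRealSubfield L))]
    (μ' : Measure (v.adicCompletion (maximalRealSubfield L))) [μ'.IsAddHaarMeasure] :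
    haveI := secondCountableTopology_adicCompletion (maximalRealSubfield L) v
    ∃ U : UnitaryGroup.localPi L (IsCMField.complexConj L) n J v →*
        (Lp ℂ 2 (Measure.pi fun _ : Fin n => μ') ≃ₗᵢ[ℂ] Lp ℂ 2 (Measure.pi fun _ : Fin n => μ')),
      (∀ f, Continuous fun g => U g f) ∧
      ∀ (g : UnitaryGroup.localPi L (IsCMField.complexConj L) n J v)
        (Φ : SchwartzBruhat (Fin n → v.adicCompletion (maximalRealSubfield L))),
        U g (SchwartzBruhat.toLp (Measure.pi fun _ : Fin n => μ') Φ) =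
          SchwartzBruhat.toLp (Measure.pi fun _ : Fin n => μ') (((finLocalSplittingsCM L n hT₀ hT₀d hJ χ hχ).omegaLoc v) g Φ) := by
  haveI := secondCountableTopology_adicCompletion (maximalRealSubfield L) v
  have h := FinLocalSplittings.isL2Isometric_omegaLoc_finLocalSplittingsCM L n hT₀ hT₀d hJ χ hχ v hχu μ'
  exact ⟨h.toUnitaryRep (SchwartzBruhat.denseRange_toLp_adicCompletionPi (maximalRealSubfield L) v n μ'),
    h.continuous_toUnitaryRep_apply_of_isSmooth _ ((finLocalSplittingsCM L n hT₀ hT₀d hJ χ hχ).isSmooth_omegaLoc v),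
    fun g Φ => Representation.IsL2Isometric.toUnitaryRep_apply_toLp _ _ g Φ⟩

end CM

end Literature.NumberTheory.GelbartRogawski1991.UnitaryDualPair.LocalSplitting

/-! ### The END-display shape `congrW … (undoubledSplittings … (cmFinLocalFamily χ))` -/

namespace Literature.NumberTheory.GelbartRogawski1991.GRConstruction

open UnitaryDualPair
open Literature.NumberTheory.GelbartRogawski1991.UnitaryDualPair.LocalSplitting hiding IsSiegelDelta chiDet deltaBlock
  detDelta e₂ gramD gramD_isSymm gramS hermD isUnit_det_gramD

variable (L : Type) [Field L] [NumberField L] [IsCMField L]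
variable {N M n : ℕ} (e : Fin N × Fin M ≃ Fin n)
  (dV : Fin N → L) (hdV : ∀ i, IsCMField.complexConj L (dV i) = dV i) (hdV0 : ∀ i, dV i ≠ 0)
  (dW : Fin M → L) (hdW : ∀ i, IsCMField.complexConj L (dW i) = dW i) (hdW0 : ∀ i, dW i ≠ 0)
  (χ : HeckeCharacter L) (hχ : IsSplittingChar L 1 χ) (𝔪 : ∀ v, PlaceMeasure L v)
  (v : HeightOneSpectrum (𝓞 (Fp L)))
  {TW' : Matrix (Fin M) (Fin M) (Fp L)} {JW' : Matrix (Fin M) (Fin M) L}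

/-- **the local Weil representation of the END display's family of local splittings** (`congrW … (undoubledSplittings …
(cmFinLocalFamily χ …))`, the shape of `muLocalSplittings` of the COR-CM cell) **is, at every finite place `v` of `L⁺`, the
restriction of a strongly continuous UNITARY REPRESENTATION of `U(diag dV ⊗ J_{W′})(L⁺_v)` on `L²((L⁺_v)ⁿ, μ'ⁿ)`** (`χ` unitary;
any Borel structure, any Haar `μ'`). [cite: GelbartRogawski1991, §3.1 Prop. 3.1.1 p. 455 L1–3, p. 454 L21–25] [cite: Weil1964, Chap. I n° 13] -/
theorem exists_unitaryRep_omegaLoc_congrW_undoubledSplittings_cmFinLocalFamily (hχu : χ.IsUnitary)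
    (hT : realDiagonal L dW hdW = TW') (hJ : Matrix.diagonal dW = JW') (hW' : TW'.IsSymm)
    (hJW' : JW' = TW'.map (algebraMap (Fp L) L))
    [MeasurableSpace (v.adicCompletion (Fp L))] [BorelSpace (v.adicCompletion (Fp L))]
    (μ' : Measure (v.adicCompletion (Fp L))) [μ'.IsAddHaarMeasure] :
    haveI := secondCountableTopology_adicCompletion (Fp L) v
    ∃ U : UnitaryGroup.localPi L (IsCMField.complexConj L) n (Matrix.reindex e e (Matrix.diagonal dV ⊗ₖ JW')) v →*
        (Lp ℂ 2 (Measure.pi fun _ : Fin n => μ') ≃ₗᵢ[ℂ] Lp ℂ 2 (Measure.pi fun _ : Fin n => μ')),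
      (∀ f, Continuous fun g => U g f) ∧
      ∀ (g : UnitaryGroup.localPi L (IsCMField.complexConj L) n (Matrix.reindex e e (Matrix.diagonal dV ⊗ₖ JW')) v)
        (Φ : SchwartzBruhat (Fin n → v.adicCompletion (Fp L))),
        U g (SchwartzBruhat.toLp (Measure.pi fun _ : Fin n => μ') Φ) =
          SchwartzBruhat.toLp (Measure.pi fun _ : Fin n => μ')
            (((congrW L e dV hdV dW hdW hT hJ
                (undoubledSplittings L e dV hdV hdV0 dW hdW hdW0 χ 𝔪 (cmFinLocalFamily L e dV hdV hdV0 dW hdW hdW0 χ hχ 𝔪))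
                hW' hJW').omegaLoc v) g Φ) := by
  haveI := secondCountableTopology_adicCompletion (Fp L) v
  have h := isL2Isometric_omegaLoc_congrW_undoubledSplittings_cmFinLocalFamily L e dV hdV hdV0 dW hdW hdW0 χ hχ 𝔪 v hχu hT hJ
    hW' hJW' μ'
  exact ⟨h.toUnitaryRep (SchwartzBruhat.denseRange_toLp_adicCompletionPi (Fp L) v n μ'),
    h.continuous_toUnitaryRep_apply_of_isSmooth _ (FinLocalSplittings.isSmooth_omegaLoc _ v),
    fun g Φ => Representation.IsL2Isometric.toUnitaryRep_apply_toLp _ _ g Φ⟩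

end Literature.NumberTheory.GelbartRogawski1991.GRConstruction

end
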